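import Summits.Ventures.CertifiedArithmetic.LowPrec.GemmEnvelopeOnsetPairs

/-!
# GEMM-level envelopes, part (z): ROW P5 AT THE OUTPUT LEVEL FOR BLOCKS OF LENGTH 2 AND 1 — the no-witness half (pub-lowprec gemm gen 24, LXXII-b)

HONEST FRAMING: certified error envelopes and provably optimal rounding/accumulation schemes for
low-precision formats under stated cost models; every table by two implementations; no hardware or vendor
claims.

Row P5 (MX-E4M3-ceil against the per-vector constant `C_Π = 35/289 + (γ̄ + δ̄(1 + γ̄))·324/289`) at the
OUTPUT of the pipeline (`|acc - ΣΣ q̂a q̂b| ≤ γ·ΣΣ|q̂a q̂b|`, `γ ≤ γ̄`; `|c - acc| ≤ δ·|acc|`, `δ ≤ δ̄`).  Parts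
(u)/(v) decided blocks of length `≥ 3` (onset EXACTLY `κ_Π ≈ 15245.92` at the caps of record, realised by a
sliver·sliver cell `v·v`).  For blocks of LENGTH 2 such a cell needs an ALIGNED block pair, where it is
dwarfed by the max·max cell (`|v·v'| < |A·A'|/14336²`) and ABSORBED by its slack (part (y)); every other cell
has a normal factor and carries a ratio in the crossed band `[(16/17)ρ_lo, (18/17)R]`, `R` the sliver-ratio
bound of part (y)'s two-rung band.  This file proves the generic no-witness half for `k = 2` (and `k = 1`);
part (aa) `GemmEnvelopeOnsetTwo` adds the witness half at the caps of record: there the onset for `k = 2` is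
EXACTLY `onset₂ = 16384·(17/18)·(1 + C_Π)/((1 - γ̄)(1 - δ̄)) = 608995584/34799 ≈ 17500.376` (second sliver rung;
at caps whose first-rung value `14336·(17/18)(1 + C)/((1 - γ̄)(1 - δ̄))` is `≤ 229376/15`, e.g. `(0, 0)`, the onset
is that value instead — `θ = 258048/17` at `(0, 0)`, part (h); the generic theorem below covers both cases).

* `pair_bounds_of_trichotomy` (abstract) / `mxCeil_pair_bounds_two`: for ONE block pair of length 2 on
  `C(κ)`, `κ ≤ 229376/13`, caps `0 ≤ γ̄, δ̄ ≤ 1`, `C ≥ 0`, the two summed bracket expressions of part (y) are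
  `≤ C·Σ|a b|` whenever `(1 - γ̄)(1 - δ̄)·(18/17)R ≤ 1 + C`, `1 - (1 - δ̄)(1 + γ̄)·(16/17)ρ_lo ≤ C` (cells with a
  normal factor) and `(1 - γ̄)(1 - δ̄)·324/289 + (1 + R²)/14336² ≤ 1 + C`,
  `1 - (1 - δ̄)(1 + γ̄)·256/289 + (1 + R²)/14336² ≤ C` (the max·max cell absorbing a sliver·sliver partner).
* `row_P5_two_no_output_witness`: then EVERY input of `C(κ)` (blocks of length 2, any `B`) admits an
  admissible realisation with `|c - S| ≤ C·L` — it is not an output-level witness against `C`;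
  `row_P5_two_no_output_witness_below`: the instance at the caps of record `(1/2048, 1/257)` and `C_Π` — for
  every `κ` with `34799·κ ≤ 608995584` (`κ ≤ onset₂`), every `B` (`ρ_lo = 14/15`; `R = 16/15` up to
  `κ = 16384·16/15`, `R = κ/16384` beyond; the binding condition `(1 - γ̄)(1 - δ̄)(18/17)(κ/16384) ≤ 1 + C_Π`).
* `row_P5_one_no_output_witness` / `row_P5_one_no_output_witness_caps`: blocks of length 1 are never a
  witness (every element is its own block maximum, hence normal; no class hypothesis, every `κ`).
* The `(γ̄, δ̄) = (0, 0)` corner is NOT an instance (the absorption hair `(1 + R²)/14336²` exceeds the zero slack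
  of `324/289 = 1 + 35/289`); there the quantiser-level parts (n), (f), (h) decide.

Exact rational algebra over the kernel definitions; caps are hypotheses, not device claims.  No `sorry`;
axioms `propext`, `Classical.choice`, `Quot.sound` only.  [cite: RouhaniEtAl2023MX, §5.1]
[cite: MicikeviciusEtAl2022, §3] [cite: Higham2002ASNA, §3.1]
-/

namespace Summit.Ventures.CertifiedArithmetic.LowPrec.GemmEnvelope

open Finset
open Literature.ComputerArithmetic.FloatingPoint
open Literature.ComputerArithmetic.FloatingPoint.Format
open Literature.ComputerArithmetic.FloatingPoint.MiniFloat
open Literature.ComputerArithmetic.FloatingPoint.MXBlock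
open Summit.Ventures.CertifiedArithmetic.LowPrec.SR

/-! ## One block pair of length 2: crossed pairs are banded, aligned pairs absorb -/

/-- **PAIR BOUNDS FROM THE TRICHOTOMY (abstract).**  Blocks `a, b : Fin 2 → ℚ` with quantised values `qa, qb`,
indices `ia, ib` of maximal modulus; every element is `ρ·v` with `ρ ∈ [ρ_lo, R]` (`0 ≤ ρ_lo`), and is either
normal (`ρ ∈ [16/17, 18/17]`) or small (`14336|v| <` the maximal modulus).  Under the four onset conditions the
two summed bracket expressions are `≤ C·Σ|a b|`: a crossed pair (`ia ≠ ib`) has a normal factor in each cell;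
an aligned pair's second cell has a normal factor or is absorbed by the max·max cell (`ε = 1/14336²`,
`R' = R²`). [cite: RouhaniEtAl2023MX, §5.1] [cite: Higham2002ASNA, §3.1] -/
theorem pair_bounds_of_trichotomy (a b qa qb : Fin 2 → ℚ) (ia ib : Fin 2) {ρlo R γ δ C : ℚ}
    (hρ0 : 0 ≤ ρlo)
    (hWa : ∀ i, ∃ ρ, ρlo ≤ ρ ∧ ρ ≤ R ∧ qa i = ρ * a i)
    (hWb : ∀ i, ∃ ρ, ρlo ≤ ρ ∧ ρ ≤ R ∧ qb i = ρ * b i)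
    (hNa : ∀ i, (∃ ρ, 16 / 17 ≤ ρ ∧ ρ ≤ 18 / 17 ∧ qa i = ρ * a i) ∨ 14336 * |a i| < |a ia|)
    (hNb : ∀ i, (∃ ρ, 16 / 17 ≤ ρ ∧ ρ ≤ 18 / 17 ∧ qb i = ρ * b i) ∨ 14336 * |b i| < |b ib|)
    (hC : 0 ≤ C) (hγ0 : 0 ≤ γ) (hγ1 : γ ≤ 1) (hδ0 : 0 ≤ δ) (hδ1 : δ ≤ 1)
    (hup : (1 - γ) * (1 - δ) * (18 / 17 * R) ≤ 1 + C)
    (hdn : 1 - (1 - δ) * (1 + γ) * (16 / 17 * ρlo) ≤ C)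
    (hupA : (1 - γ) * (1 - δ) * (324 / 289) + (1 + R ^ 2) / 14336 ^ 2 ≤ 1 + C)
    (hdnA : 1 - (1 - δ) * (1 + γ) * (256 / 289) + (1 + R ^ 2) / 14336 ^ 2 ≤ C) :
    (∑ i, (a i * b i - (1 - δ) * (qa i * qb i + γ * |qa i * qb i|)) ≤ C * ∑ i, |a i * b i|) ∧
      (∑ i, ((1 - δ) * (qa i * qb i - γ * |qa i * qb i|) - a i * b i) ≤ C * ∑ i, |a i * b i|) := by
  have h16 : (0 : ℚ) ≤ 16 / 17 * ρlo := mul_nonneg (by norm_num) hρ0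
  -- (1) a cell with a normal factor satisfies the per-cell bounds of the crossed band
  have hcell : ∀ i, ((∃ ρ, 16 / 17 ≤ ρ ∧ ρ ≤ 18 / 17 ∧ qa i = ρ * a i) ∨
      (∃ σ, 16 / 17 ≤ σ ∧ σ ≤ 18 / 17 ∧ qb i = σ * b i)) →
      (a i * b i - (1 - δ) * (qa i * qb i + γ * |qa i * qb i|) ≤ C * |a i * b i|) ∧
      ((1 - δ) * (qa i * qb i - γ * |qa i * qb i|) - a i * b i ≤ C * |a i * b i|) := by
    intro i h
    rcases h with ⟨ρ, h1, h2, hq⟩ | ⟨σ, h1, h2, hq⟩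
    · obtain ⟨σ, h3, h4, hq'⟩ := hWb i
      refine onset_cell_bounds (r := ρ * σ) hγ0 hγ1 hδ1 h16 ?_ ?_ ?_ hup hdn
      · exact mul_le_mul h1 h3 hρ0 (by linarith)
      · exact mul_le_mul h2 h4 (by linarith) (by norm_num)
      · rw [hq, hq']; ring
    · obtain ⟨ρ, h3, h4, hq'⟩ := hWa i
      refine onset_cell_bounds (r := σ * ρ) hγ0 hγ1 hδ1 h16 ?_ ?_ ?_ hup hdn
      · exact mul_le_mul h1 h3 hρ0 (by linarith)
      · exact mul_le_mul h2 h4 (by linarith) (by norm_num)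
      · rw [hq, hq']; ring
  -- (2) summing per-cell bounds
  have hsum : (∀ i, (a i * b i - (1 - δ) * (qa i * qb i + γ * |qa i * qb i|) ≤ C * |a i * b i|) ∧
      ((1 - δ) * (qa i * qb i - γ * |qa i * qb i|) - a i * b i ≤ C * |a i * b i|)) →
      (∑ i, (a i * b i - (1 - δ) * (qa i * qb i + γ * |qa i * qb i|)) ≤ C * ∑ i, |a i * b i|) ∧
      (∑ i, ((1 - δ) * (qa i * qb i - γ * |qa i * qb i|) - a i * b i) ≤ C * ∑ i, |a i * b i|) := by
    intro h
    constructor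
    · calc ∑ i, (a i * b i - (1 - δ) * (qa i * qb i + γ * |qa i * qb i|))
          ≤ ∑ i, C * |a i * b i| := sum_le_sum fun i _ => (h i).1
        _ = C * ∑ i, |a i * b i| := by rw [mul_sum]
    · calc ∑ i, ((1 - δ) * (qa i * qb i - γ * |qa i * qb i|) - a i * b i)
          ≤ ∑ i, C * |a i * b i| := sum_le_sum fun i _ => (h i).2
        _ = C * ∑ i, |a i * b i| := by rw [mul_sum]
  -- (3) the maxima are normal
  have hNia : ∃ ρ, 16 / 17 ≤ ρ ∧ ρ ≤ 18 / 17 ∧ qa ia = ρ * a ia := by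
    rcases hNa ia with h | h
    · exact h
    · exfalso; linarith [abs_nonneg (a ia)]
  have hNib : ∃ ρ, 16 / 17 ≤ ρ ∧ ρ ≤ 18 / 17 ∧ qb ib = ρ * b ib := by
    rcases hNb ib with h | h
    · exact h
    · exfalso; linarith [abs_nonneg (b ib)]
  -- (4) every cell has a normal factor, or both of its factors are small
  have hdich : ∀ i, ((∃ ρ, 16 / 17 ≤ ρ ∧ ρ ≤ 18 / 17 ∧ qa i = ρ * a i) ∨
      (∃ σ, 16 / 17 ≤ σ ∧ σ ≤ 18 / 17 ∧ qb i = σ * b i)) ∨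
      (14336 * |a i| < |a ia| ∧ 14336 * |b i| < |b ib|) := by
    intro i
    rcases hNa i with h | h
    · exact Or.inl (Or.inl h)
    rcases hNb i with h' | h'
    · exact Or.inl (Or.inr h')
    · exact Or.inr ⟨h, h'⟩
  -- (5) absorption of a small·small cell `i` by the cell `ia` when `b ia` is normal too (aligned pair)
  have habs : ∀ i, (∃ σ, 16 / 17 ≤ σ ∧ σ ≤ 18 / 17 ∧ qb ia = σ * b ia) →
      14336 * |a i| < |a ia| → 14336 * |b i| < |b ia| →
      (a ia * b ia - (1 - δ) * (qa ia * qb ia + γ * |qa ia * qb ia|) +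
          (a i * b i - (1 - δ) * (qa i * qb i + γ * |qa i * qb i|)) ≤ C * (|a ia * b ia| + |a i * b i|)) ∧
      ((1 - δ) * (qa ia * qb ia - γ * |qa ia * qb ia|) - a ia * b ia +
          ((1 - δ) * (qa i * qb i - γ * |qa i * qb i|) - a i * b i) ≤ C * (|a ia * b ia| + |a i * b i|)) := by
    intro i hσ h1 h2
    obtain ⟨ρ, hρa, hρb, hq⟩ := hNia
    obtain ⟨σ, hσa, hσb, hq'⟩ := hσ
    obtain ⟨ρ', h3, h4, hq3⟩ := hWa i
    obtain ⟨σ', h5, h6, hq4⟩ := hWb i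
    have hρ'0 : 0 ≤ ρ' := le_trans hρ0 h3
    have hσ'0 : 0 ≤ σ' := le_trans hρ0 h5
    refine absorb_cell_bounds (r := ρ * σ) (rlo := 256 / 289) (rhi := 324 / 289) (r' := ρ' * σ')
      (R' := R ^ 2) (ε := 1 / 14336 ^ 2) hγ0 hγ1 hδ0 hδ1 hC (by norm_num) ?_ ?_ ?_
      (mul_nonneg hρ'0 hσ'0) ?_ ?_ ?_ (by linarith) (by linarith)
    · have := mul_le_mul hρa hσa (by norm_num) (by linarith)
      linarith
    · have := mul_le_mul hρb hσb (by linarith) (by norm_num)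
      linarith
    · rw [hq, hq']; ring
    · rw [sq]; exact mul_le_mul h4 h6 hσ'0 (le_trans hρ'0 h4)
    · rw [hq3, hq4]; ring
    · rw [abs_mul, abs_mul]
      have := mul_le_mul h1.le h2.le (by positivity) (abs_nonneg _)
      nlinarith [abs_nonneg (a i), abs_nonneg (b i)]
  -- (6) the four position cases
  have h2 : ∀ i : Fin 2, i = 0 ∨ i = 1 := by
    intro i; fin_cases i
    · exact Or.inl rfl
    · exact Or.inr rfl
  rcases h2 ia with rfl | rfl <;> rcases h2 ib with rfl | rfl
  · -- aligned at 0
    rcases hdich 1 with h | ⟨h1, h2⟩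
    · exact hsum (Fin.forall_fin_two.mpr ⟨hcell 0 (Or.inl hNia), hcell 1 h⟩)
    · obtain ⟨H1, H2⟩ := habs 1 hNib h1 h2
      rw [Fin.sum_univ_two, Fin.sum_univ_two, Fin.sum_univ_two]
      exact ⟨by linarith, by linarith⟩
  · -- crossed: `a` maximal at 0, `b` maximal at 1
    exact hsum (Fin.forall_fin_two.mpr ⟨hcell 0 (Or.inl hNia), hcell 1 (Or.inr hNib)⟩)
  · -- crossed: `a` maximal at 1, `b` maximal at 0
    exact hsum (Fin.forall_fin_two.mpr ⟨hcell 0 (Or.inr hNib), hcell 1 (Or.inl hNia)⟩)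
  · -- aligned at 1
    rcases hdich 0 with h | ⟨h1, h2⟩
    · exact hsum (Fin.forall_fin_two.mpr ⟨hcell 0 h, hcell 1 (Or.inl hNia)⟩)
    · obtain ⟨H1, H2⟩ := habs 0 hNib h1 h2
      rw [Fin.sum_univ_two, Fin.sum_univ_two, Fin.sum_univ_two]
      exact ⟨by linarith, by linarith⟩

/-- **MX-E4M3 PAIR BOUNDS, BLOCKS OF LENGTH 2.**  On `C(κ)`, `κ ≤ 229376/13`, with `0 ≤ ρ_lo ≤ 16/17`
(`ρ_lo ≤ 14/15` once `229376/15 < κ`), `R ≥ 18/17`, `R ≥ min(κ/14336, 16/15)`, `R ≥ κ/16384`, caps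
`0 ≤ γ̄, δ̄ ≤ 1`, `C ≥ 0` and the four onset conditions, one MX-E4M3-ceil block pair of length 2 satisfies both
summed bracket bounds. [cite: RouhaniEtAl2023MX, §5.1] -/
theorem mxCeil_pair_bounds_two (a b : Fin 2 → ℚ) {κ ρlo R γ δ C : ℚ}
    (ha : ∀ i, a i = 0 ∨ blockMax a ≤ κ * |a i|) (hb : ∀ i, b i = 0 ∨ blockMax b ≤ κ * |b i|)
    (hκM : κ ≤ 229376 / 13) (hρ0 : 0 ≤ ρlo) (hρ1 : ρlo ≤ 16 / 17) (hρ2 : 229376 / 15 < κ → ρlo ≤ 14 / 15)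
    (hR : 18 / 17 ≤ R) (hR1 : min (κ / 14336) (16 / 15) ≤ R) (hR2 : κ / 16384 ≤ R)
    (hC : 0 ≤ C) (hγ0 : 0 ≤ γ) (hγ1 : γ ≤ 1) (hδ0 : 0 ≤ δ) (hδ1 : δ ≤ 1)
    (hup : (1 - γ) * (1 - δ) * (18 / 17 * R) ≤ 1 + C)
    (hdn : 1 - (1 - δ) * (1 + γ) * (16 / 17 * ρlo) ≤ C)
    (hupA : (1 - γ) * (1 - δ) * (324 / 289) + (1 + R ^ 2) / 14336 ^ 2 ≤ 1 + C)
    (hdnA : 1 - (1 - δ) * (1 + γ) * (256 / 289) + (1 + R ^ 2) / 14336 ^ 2 ≤ C) :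
    (∑ i, (a i * b i - (1 - δ) *
        ((ceilScale E4M3 a * (roundNE E4M3 (a i / ceilScale E4M3 a)).toRat) *
            (ceilScale E4M3 b * (roundNE E4M3 (b i / ceilScale E4M3 b)).toRat) +
          γ * |(ceilScale E4M3 a * (roundNE E4M3 (a i / ceilScale E4M3 a)).toRat) *
            (ceilScale E4M3 b * (roundNE E4M3 (b i / ceilScale E4M3 b)).toRat)|)) ≤ C * ∑ i, |a i * b i|) ∧
      (∑ i, ((1 - δ) *
        ((ceilScale E4M3 a * (roundNE E4M3 (a i / ceilScale E4M3 a)).toRat) *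
            (ceilScale E4M3 b * (roundNE E4M3 (b i / ceilScale E4M3 b)).toRat) -
          γ * |(ceilScale E4M3 a * (roundNE E4M3 (a i / ceilScale E4M3 a)).toRat) *
            (ceilScale E4M3 b * (roundNE E4M3 (b i / ceilScale E4M3 b)).toRat)|) - a i * b i)
        ≤ C * ∑ i, |a i * b i|) := by
  obtain ⟨ia, hia⟩ := exists_forall_abs_le_two a
  obtain ⟨ib, hib⟩ := exists_forall_abs_le_two b
  have hBa : blockMax a = |a ia| := blockMax_eq_of_forall_le hia rfl
  have hBb : blockMax b = |b ib| := blockMax_eq_of_forall_le hib rfl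
  exact pair_bounds_of_trichotomy a b
    (fun i => ceilScale E4M3 a * (roundNE E4M3 (a i / ceilScale E4M3 a)).toRat)
    (fun i => ceilScale E4M3 b * (roundNE E4M3 (b i / ceilScale E4M3 b)).toRat) ia ib hρ0
    (fun i => mxCeil_ratio_band_two_rungs a i (ha i) hκM hρ1 hρ2 hR hR1 hR2)
    (fun i => mxCeil_ratio_band_two_rungs b i (hb i) hκM hρ1 hρ2 hR hR1 hR2)
    (fun i => (mxCeil_normal_or_small a i).imp_right fun h => by rw [← hBa]; exact h.2.2)
    (fun i => (mxCeil_normal_or_small b i).imp_right fun h => by rw [← hBb]; exact h.2.2)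
    hC hγ0 hγ1 hδ0 hδ1 hup hdn hupA hdnA

/-! ## Row P5, blocks of length 2: the no-witness half below `onset₂` -/

/-- **ROW P5, LENGTH 2, NO OUTPUT-LEVEL WITNESS (generic caps and constant).**  On `C(κ)`, `κ ≤ 229376/13`,
with `ρ_lo`, `R` as in `mxCeil_pair_bounds_two`, caps `0 ≤ γ̄, δ̄ ≤ 1`, `C ≥ 0` and the four onset conditions —
the binding one is `(1 - γ̄)(1 - δ̄)·(18/17)·R ≤ 1 + C` with `R = max(16/15, κ/16384)`, i.e. `κ ≤ onset₂` —
EVERY input of MX-E4M3-ceil blocks of length 2 admits a realisation of the pipeline with `|c - S| ≤ C·L`.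
[cite: RouhaniEtAl2023MX, §5.1] [cite: Higham2002ASNA, §3.1] -/
theorem row_P5_two_no_output_witness {B : ℕ} (a b : Fin B → Fin 2 → ℚ) {Aa Ab κ ρlo R γ δ C : ℚ}
    (hκM : κ ≤ 229376 / 13) (hρ0 : 0 ≤ ρlo) (hρ1 : ρlo ≤ 16 / 17) (hρ2 : 229376 / 15 < κ → ρlo ≤ 14 / 15)
    (hR : 18 / 17 ≤ R) (hR1 : min (κ / 14336) (16 / 15) ≤ R) (hR2 : κ / 16384 ≤ R)
    (hC : 0 ≤ C) (hγ0 : 0 ≤ γ) (hγ1 : γ ≤ 1) (hδ0 : 0 ≤ δ) (hδ1 : δ ≤ 1)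
    (hup : (1 - γ) * (1 - δ) * (18 / 17 * R) ≤ 1 + C)
    (hdn : 1 - (1 - δ) * (1 + γ) * (16 / 17 * ρlo) ≤ C)
    (hupA : (1 - γ) * (1 - δ) * (324 / 289) + (1 + R ^ 2) / 14336 ^ 2 ≤ 1 + C)
    (hdnA : 1 - (1 - δ) * (1 + γ) * (256 / 289) + (1 + R ^ 2) / 14336 ^ 2 ≤ C)
    (ha : ∀ j i, |a j i| ≤ Aa ∧ (a j i = 0 ∨ Aa ≤ κ * |a j i|))
    (hb : ∀ j i, |b j i| ≤ Ab ∧ (b j i = 0 ∨ Ab ≤ κ * |b j i|)) :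
    ∃ acc c : ℚ,
      |acc - ∑ j, ∑ i, (ceilScale E4M3 (a j) * (roundNE E4M3 (a j i / ceilScale E4M3 (a j))).toRat) *
          (ceilScale E4M3 (b j) * (roundNE E4M3 (b j i / ceilScale E4M3 (b j))).toRat)|
        ≤ γ * ∑ j, ∑ i, |(ceilScale E4M3 (a j) * (roundNE E4M3 (a j i / ceilScale E4M3 (a j))).toRat) *
          (ceilScale E4M3 (b j) * (roundNE E4M3 (b j i / ceilScale E4M3 (b j))).toRat)| ∧
      |c - acc| ≤ δ * |acc| ∧
      |c - ∑ j, ∑ i, a j i * b j i| ≤ C * ∑ j, ∑ i, |a j i * b j i| :=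
  no_output_witness_of_block_bounds (fun j i => a j i * b j i)
    (fun j i => (ceilScale E4M3 (a j) * (roundNE E4M3 (a j i / ceilScale E4M3 (a j))).toRat) *
      (ceilScale E4M3 (b j) * (roundNE E4M3 (b j i / ceilScale E4M3 (b j))).toRat)) hC hγ0 hδ0
    fun j => mxCeil_pair_bounds_two (a j) (b j) (fun i => class_blockMax_le a ha j i)
      (fun i => class_blockMax_le b hb j i) hκM hρ0 hρ1 hρ2 hR hR1 hR2 hC hγ0 hγ1 hδ0 hδ1 hup hdn hupA hdnA

/-- **ROW P5, LENGTH 2, BELOW THE ONSET `onset₂`.**  At the caps `(γ̄, δ̄) = (1/2048, 1/257)` and the per-vector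
constant `C_Π`, for every `κ` with `34799·κ ≤ 608995584` (`κ ≤ onset₂ = 16384·(17/18)·R_Π² ≈ 17500.376`) NO
input of `C(κ)` with MX blocks of length 2 is an output-level witness of `¬(MXC ≼ VEC)`: some realisation
has `|c - S| ≤ C_Π·L` — for every `B`.  (`ρ_lo = 14/15`; `R = 16/15` up to `κ = 16384·16/15`, `R = κ/16384`
beyond.) [cite: RouhaniEtAl2023MX, §5.1] [cite: MicikeviciusEtAl2022, §3] -/
theorem row_P5_two_no_output_witness_below {B : ℕ} {κ : ℚ} (hκ : 34799 * κ ≤ 608995584)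
    (a b : Fin B → Fin 2 → ℚ) {Aa Ab : ℚ}
    (ha : ∀ j i, |a j i| ≤ Aa ∧ (a j i = 0 ∨ Aa ≤ κ * |a j i|))
    (hb : ∀ j i, |b j i| ≤ Ab ∧ (b j i = 0 ∨ Ab ≤ κ * |b j i|)) :
    ∃ acc c : ℚ,
      |acc - ∑ j, ∑ i, (ceilScale E4M3 (a j) * (roundNE E4M3 (a j i / ceilScale E4M3 (a j))).toRat) *
          (ceilScale E4M3 (b j) * (roundNE E4M3 (b j i / ceilScale E4M3 (b j))).toRat)|
        ≤ 1 / 2048 * ∑ j, ∑ i, |(ceilScale E4M3 (a j) * (roundNE E4M3 (a j i / ceilScale E4M3 (a j))).toRat) *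
          (ceilScale E4M3 (b j) * (roundNE E4M3 (b j i / ceilScale E4M3 (b j))).toRat)| ∧
      |c - acc| ≤ 1 / 257 * |acc| ∧
      |c - ∑ j, ∑ i, a j i * b j i|
        ≤ (35 / 289 + 1 / 2048 * (324 / 289) + 1 / 257 * (324 / 289) * (1 + 1 / 2048))
          * ∑ j, ∑ i, |a j i * b j i| := by
  by_cases h1 : κ ≤ 16 / 15 * 16384
  · exact row_P5_two_no_output_witness a b (ρlo := 14 / 15) (R := 16 / 15) (by linarith) (by norm_num)
      (by norm_num) (fun _ => le_rfl) (by norm_num) (min_le_right _ _) (by linarith) (by norm_num)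
      (by norm_num) (by norm_num) (by norm_num) (by norm_num) (by norm_num) (by norm_num) (by norm_num)
      (by norm_num) ha hb
  · push Not at h1
    have hκM : κ ≤ 229376 / 13 := by linarith
    have hκ2 : κ * κ ≤ 229376 / 13 * (229376 / 13) := mul_le_mul hκM hκM (by linarith) (by norm_num)
    exact row_P5_two_no_output_witness a b (ρlo := 14 / 15) (R := κ / 16384) hκM (by norm_num)
      (by norm_num) (fun _ => le_rfl) (by linarith) (le_trans (min_le_right _ _) (by linarith)) le_rfl
      (by norm_num) (by norm_num) (by norm_num) (by norm_num) (by norm_num) (by linarith) (by norm_num)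
      (by rw [div_pow]; nlinarith) (by rw [div_pow]; nlinarith) ha hb

/-! ## Row P5, blocks of length 1: never an output-level witness -/

/-- **ROW P5, LENGTH 1 (generic caps and constant, every input).**  Every element of an MX block of length 1
is its own maximum, hence normal: every cell carries a ratio in `[256/289, 324/289]`, so whenever
`(1 - γ̄)(1 - δ̄)·324/289 ≤ 1 + C` and `1 - (1 - δ̄)(1 + γ̄)·256/289 ≤ C` (caps in `[0, 1]`, `C ≥ 0`) EVERY
input — no class hypothesis — admits a realisation with `|c - S| ≤ C·L`.  At the caps of record and `C_Π` both
conditions hold (`row_P5_one_no_output_witness_caps`). [cite: RouhaniEtAl2023MX, §5.1] -/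
theorem row_P5_one_no_output_witness {B : ℕ} (a b : Fin B → Fin 1 → ℚ) {γ δ C : ℚ}
    (hC : 0 ≤ C) (hγ0 : 0 ≤ γ) (hγ1 : γ ≤ 1) (hδ0 : 0 ≤ δ) (hδ1 : δ ≤ 1)
    (hup : (1 - γ) * (1 - δ) * (324 / 289) ≤ 1 + C) (hdn : 1 - (1 - δ) * (1 + γ) * (256 / 289) ≤ C) :
    ∃ acc c : ℚ,
      |acc - ∑ j, ∑ i, (ceilScale E4M3 (a j) * (roundNE E4M3 (a j i / ceilScale E4M3 (a j))).toRat) *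
          (ceilScale E4M3 (b j) * (roundNE E4M3 (b j i / ceilScale E4M3 (b j))).toRat)|
        ≤ γ * ∑ j, ∑ i, |(ceilScale E4M3 (a j) * (roundNE E4M3 (a j i / ceilScale E4M3 (a j))).toRat) *
          (ceilScale E4M3 (b j) * (roundNE E4M3 (b j i / ceilScale E4M3 (b j))).toRat)| ∧
      |c - acc| ≤ δ * |acc| ∧
      |c - ∑ j, ∑ i, a j i * b j i| ≤ C * ∑ j, ∑ i, |a j i * b j i| := by
  have key := no_output_witness_of_ratio_band (ι := Fin B × Fin 1) (fun x => a x.1 x.2 * b x.1 x.2)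
    (fun x => (ceilScale E4M3 (a x.1) * (roundNE E4M3 (a x.1 x.2 / ceilScale E4M3 (a x.1))).toRat) *
      (ceilScale E4M3 (b x.1) * (roundNE E4M3 (b x.1 x.2 / ceilScale E4M3 (b x.1))).toRat))
    (rlo := 256 / 289) (rhi := 324 / 289) (γ := γ) (δ := δ) (C := C) hC hγ0 hγ1 hδ0 hδ1 (by norm_num)
    (fun x => by
      obtain ⟨ρ, h1, h2, hq⟩ := mxCeil_ratio_of_max (a x.1) x.2 (fun i' => by rw [Subsingleton.elim i' x.2])
      obtain ⟨σ, h3, h4, hq'⟩ := mxCeil_ratio_of_max (b x.1) x.2 (fun i' => by rw [Subsingleton.elim i' x.2])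
      refine ⟨ρ * σ, ?_, ?_, ?_⟩
      · have := mul_le_mul h1 h3 (by norm_num) (by linarith); linarith
      · have := mul_le_mul h2 h4 (by linarith) (by norm_num); linarith
      · rw [hq, hq']; ring) hup hdn
  simp only [Fintype.sum_prod_type] at key
  exact key

/-- Row P5, length 1, at the caps `(1/2048, 1/257)` and `C_Π`: NO input whatsoever is an output-level witness
(every `κ`, every `B`). [cite: RouhaniEtAl2023MX, §5.1] [cite: MicikeviciusEtAl2022, §3] -/
theorem row_P5_one_no_output_witness_caps {B : ℕ} (a b : Fin B → Fin 1 → ℚ) :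
    ∃ acc c : ℚ,
      |acc - ∑ j, ∑ i, (ceilScale E4M3 (a j) * (roundNE E4M3 (a j i / ceilScale E4M3 (a j))).toRat) *
          (ceilScale E4M3 (b j) * (roundNE E4M3 (b j i / ceilScale E4M3 (b j))).toRat)|
        ≤ 1 / 2048 * ∑ j, ∑ i, |(ceilScale E4M3 (a j) * (roundNE E4M3 (a j i / ceilScale E4M3 (a j))).toRat) *
          (ceilScale E4M3 (b j) * (roundNE E4M3 (b j i / ceilScale E4M3 (b j))).toRat)| ∧
      |c - acc| ≤ 1 / 257 * |acc| ∧
      |c - ∑ j, ∑ i, a j i * b j i|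
        ≤ (35 / 289 + 1 / 2048 * (324 / 289) + 1 / 257 * (324 / 289) * (1 + 1 / 2048))
          * ∑ j, ∑ i, |a j i * b j i| :=
  row_P5_one_no_output_witness a b (by norm_num) (by norm_num) (by norm_num) (by norm_num) (by norm_num)
    (by norm_num) (by norm_num)

end Summit.Ventures.CertifiedArithmetic.LowPrec.GemmEnvelope
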